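import Literature.AlgebraicGeometry.Frobenioids.Thm36Sub
import Literature.AlgebraicGeometry.Frobenioids.PerfectionIsotropic
import Literature.AlgebraicGeometry.Frobenioids.ArchimedeanIstrProofs
import Literature.AlgebraicGeometry.Frobenioids.ArchimedeanFrobeniusIsotropic
import HarnessLib

/-!
# Frobenioids II, Theorem 3.6 (i) for `C^ℚ := C^pf` — "`(C^Λ)^istr` is of isotropic, base-trivial type",
# PROVED over THE perfection (closes the slot `Thm36Sub.istrTypes_Q`)

Mochizuki, *The geometry of Frobenioids II: poly-Frobenioids*, Kyushu J. Math. **62** (2008) 401–460, §3,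
Theorem 3.6 (i), kurims text `paper:url-4322d76898e0` p. 36: "The Frobenioid `(C^Λ)^istr` is of isotropic,
base-trivial […] type", here for `Λ = ℚ`, i.e. `C^ℚ := C^pf` (Example 3.3 (ii) p. 28: "`C^ℚ := C^pf`
[cf. [Mzk5], Definition 3.1, (iii)]") [cite: MochizukiFrdII2008, Thm 3.6 (i) p.36].

PROOF-ONLY companion of the sub-DAG statements file `Thm36Sub.lean` (abc-iut cell, layer L1, row M13, slot
`Thm36Sub.istrTypes_Q`; typed by abc-iut-w4-d074, proved here by abc-iut-w5-d161).  For THE perfection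
`PreFrobenioid.Perfection hF` of the archimedean Frobenioid `C = C₀ ×_{D₀} D → F_Φ` of Example 3.3 over ANY
base `π : D → D₀` (`hF` = print's "`C` is a Frobenioid", the input of the construction of `C^pf`):

* ISOTROPIC TYPE of `(C^pf)^istr` is the generic fact `ArchFrd.isOfIsotropicType_istr` ([FrdI] Prop. 1.9 (v):
  the inclusion of the full subcategory of isotropic objects reflects isomorphisms);
* BASE-TRIVIAL TYPE — in fact for ALL of `C^pf` (`nonempty_iso_of_baseIso`: any two objects `(A, n)`, `(B, m)`
  of `C^pf` whose base objects are isomorphic in `D` are isomorphic): by Example 3.3 (ii) "`C` is of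
  Frobenius-isotropic type" (PROVED, `Ex33ii_frobeniusIsotropic_holds`) and [FrdI] Def. 1.3 (vii)(b)
  (`PreFrobenioid.Perfection.isIsotropic_frobPow`) the chosen Frobenius powers `A^{(b)}`, `B^{(a)}` are
  ISOTROPIC objects of `C` whenever `a`, `b` are divisible enough; choosing them with `m·a = n·b` (a level of
  `((B, m), (A, n))`), the base-trivial clause of Theorem 3.6 (i) for `C` itself (`isoOverOfIsotropic`, the
  rescaling isomorphism over a base isomorphism — transported along the base-isomorphisms
  `Base(B) ≅ Base(B^{(a)})`, `Base(A) ≅ Base(A^{(b)})` of the chosen Frobenius arrows) gives an ISOMORPHISM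
  `B^{(a)} ≅ A^{(b)}` of `C`, whose class at the level `(a, b)` is an isomorphism `(B, m) ≅ (A, n)` of `C^pf`
  (`PreFrobenioid.Perfection.isIso_mk_of_isIso`, [FrdI] Prop. 3.2 (ii)).  [In words: every formal root
  `(A, n)` is isomorphic to the formal `n·b`-th root of the honest disc `A^{(b)}`, and discs over isomorphic
  bases are isomorphic.]

Classical ([FrdII] §3 is a refereed preparatory paper); nothing here takes a side on [IUTchIII] Cor. 3.12.
No statement of the paper is strengthened beyond what is proved.
-/

noncomputable section

namespace Literature.AlgebraicGeometry.Frobenioids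

open CategoryTheory Opposite

universe v u

namespace ArchFrd

namespace Thm36Sub

variable {D : Type u} [Category.{v} D] (π : D ⥤ D0)

/-! ### Isotropic Frobenius powers (Example 3.3 (ii) + [FrdI] Def. 1.3 (vii)(b)) -/

/-- Every object `A` of `C` has a "period" `d ≥ 1` all of whose multiples `a` give ISOTROPIC chosen Frobenius
powers `A^{(a)}` — "`C` is of Frobenius-isotropic type" (Ex. 3.3 (ii), `Ex33ii_frobeniusIsotropic_holds`)
combined with [FrdI] Def. 1.3 (vii)(b) (`PreFrobenioid.Perfection.isIsotropic_frobPow`).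
[cite: MochizukiFrdII2008, Ex 3.3 (ii) p.28] -/
theorem exists_dvd_isIsotropic_frobPow (hF : PreFrobenioid.IsFrobenioid (C.toElem π)) (A : C π) :
    ∃ d : ℕ+, ∀ a : ℕ+, d ∣ a → PreFrobenioid.IsIsotropic (C.toElem π) (PreFrobenioid.frobPow hF A a) := by
  obtain ⟨A', φ, hφ, hA'⟩ := Ex33ii_frobeniusIsotropic_holds π A
  exact ⟨PreFrobenioid.degFr (C.toElem π) φ, fun a ha =>
    PreFrobenioid.Perfection.isIsotropic_frobPow hF hφ hA' ha⟩

/-! ### Base-isomorphic objects of `C^pf` are isomorphic -/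

/-- **Base-triviality of THE perfection of `C`**: two objects `(A, n)`, `(B, m)` of `C^pf` whose base objects
are isomorphic in `D` are isomorphic in `C^pf` — via the class, at a level `(a, b)` with `m·a = n·b` chosen so
that `B^{(a)}` and `A^{(b)}` are isotropic, of the rescaling isomorphism `B^{(a)} ≅ A^{(b)}` of `C` over the
transported base isomorphism (Thm. 3.6 (i) base-trivial clause for `C`, `isoOverOfIsotropic`).
[cite: MochizukiFrdII2008, Thm 3.6 (i) p.36] -/
theorem nonempty_iso_of_baseIso (hF : PreFrobenioid.IsFrobenioid (C.toElem π))
    (X Y : PreFrobenioid.Perfection hF)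
    (e : PreFrobenioid.baseObj (C.toElem π) Y.obj ≅ PreFrobenioid.baseObj (C.toElem π) X.obj) :
    Nonempty (Y ≅ X) := by
  obtain ⟨dA, hdA⟩ := exists_dvd_isIsotropic_frobPow π hF X.obj
  obtain ⟨dB, hdB⟩ := exists_dvd_isIsotropic_frobPow π hF Y.obj
  -- the level `(a, b) = (n·d, m·d)`, `d = dA·dB`, of `((B, m), (A, n))`
  let a : ℕ+ := X.idx * (dA * dB)
  let b : ℕ+ := Y.idx * (dA * dB)
  have hab : Y.idx * a = X.idx * b := by
    change Y.idx * (X.idx * (dA * dB)) = X.idx * (Y.idx * (dA * dB))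
    exact mul_left_comm _ _ _
  have hBa : PreFrobenioid.IsIsotropic (C.toElem π) (PreFrobenioid.frobPow hF Y.obj a) :=
    hdB a (dvd_trans (dvd_mul_left dB dA) (dvd_mul_left (dA * dB) X.idx))
  have hAb : PreFrobenioid.IsIsotropic (C.toElem π) (PreFrobenioid.frobPow hF X.obj b) :=
    hdA b (dvd_trans (dvd_mul_right dA dB) (dvd_mul_left (dA * dB) Y.idx))
  -- the base isomorphism `Base(B^{(a)}) ≅ Base(A^{(b)})`: the chosen Frobenius arrows `B → B^{(a)}`,
  -- `A → A^{(b)}` are of Frobenius type, in particular base-isomorphisms ([FrdI] Def. 1.2 (iii))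
  haveI := PreFrobenioid.isIso_base_frob hF Y.obj a
  haveI := PreFrobenioid.isIso_base_frob hF X.obj b
  let e' : PreFrobenioid.baseObj (C.toElem π) (PreFrobenioid.frobPow hF Y.obj a) ≅
      PreFrobenioid.baseObj (C.toElem π) (PreFrobenioid.frobPow hF X.obj b) :=
    (asIso (PreFrobenioid.Base (C.toElem π) (PreFrobenioid.frob hF Y.obj a))).symm ≪≫ e ≪≫
      asIso (PreFrobenioid.Base (C.toElem π) (PreFrobenioid.frob hF X.obj b))
  -- the rescaling isomorphism of `C` between the two isotropic Frobenius powers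
  let i : PreFrobenioid.frobPow hF Y.obj a ≅ PreFrobenioid.frobPow hF X.obj b :=
    isoOverOfIsotropic π _ _ e' (isNaivelyIsotropic_fst_of_isIsotropic π _ hBa)
      (isNaivelyIsotropic_fst_of_isIsotropic π _ hAb)
  -- its class at level `(a, b)` is an isomorphism of `C^pf`
  let r : PreFrobenioid.Perfection.Rep Y X := ⟨⟨a, b, hab⟩, i.hom⟩
  haveI : IsIso (X := Y) (Y := X) (PreFrobenioid.Perfection.Hom.mk r) :=
    PreFrobenioid.Perfection.isIso_mk_of_isIso r (inferInstance : IsIso i.hom)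
  exact ⟨asIso (PreFrobenioid.Perfection.Hom.mk r)⟩

/-! ### Theorem 3.6 (i) for `C^ℚ = C^pf`: isotropic and base-trivial type -/

/-- **Thm. 3.6 (i) for `C^ℚ = C^pf`** (p. 36): "The Frobenioid `(C^Λ)^istr` is of isotropic, base-trivial […]
type", `Λ = ℚ`, PROVED over THE perfection — closes the slot `Thm36Sub.istrTypes_Q` for every value of its
parameter `hF` (the input of d9's construction of `C^pf`, print's "`C` is a Frobenioid"), i.e. the `Λ = ℚ`
base-trivial/isotropic conjunct of t9's instance statements at `pf := pfCompletion hF`.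
[cite: MochizukiFrdII2008, Thm 3.6 (i) p.36] -/
theorem istrTypes_Q_holds (hF : PreFrobenioid.IsFrobenioid (C.toElem π)) :
    Literature.AlgebraicGeometry.Frobenioids.ArchFrd.Thm36Sub.istrTypes_Q π hF := by
  refine ⟨isOfIsotropicType_istr (pfStr π hF), fun A B ⟨e⟩ => ?_⟩
  obtain ⟨i⟩ := nonempty_iso_of_baseIso π hF A.obj B.obj e.symm
  exact ⟨(PreFrobenioid.isotropicObjects (pfStr π hF)).ι.preimageIso i⟩

/-- The `Λ = ℚ` conjunct of t9's instance `Thm36i_istrTypes_C π (pfCompletion hF) rlf`-family statement —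
`Thm36i_istrTypes` for the structure functor of THE perfection — holds (definitional bridge
`archFrobenioid_pfCompletion_Q_str`). [cite: MochizukiFrdII2008, Thm 3.6 (i) p.36] -/
theorem thm36i_istrTypes_instance_Q (hF : PreFrobenioid.IsFrobenioid (C.toElem π)) (rlf : LambdaCompletion π) :
    Thm36i_istrTypes (archFrobenioid π (pfCompletion π hF) rlf .Q).str :=
  istrTypes_Q_holds π hF

end Thm36Sub

end ArchFrd

end Literature.AlgebraicGeometry.Frobenioids

end
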